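import Literature.NumberTheory.Automorphic.CDTTheorem722
import Literature.NumberTheory.Automorphic.BCDTModularity
import HarnessLib

/-!
# k2 GEN 20 sanity sketch for `stub_liftFive` (crux `FreyModularity`, stmt-ABC-11340)

Re-elaboration (today's tree) of the plan-of-record closers: the stub is closed by `exact` from
either named fact the day a `_holds` producer lands.  No `sorry`.
-/

set_option linter.dupNamespace false

noncomputable section

namespace Summit.ABC.ABC.Cruxes.FreyModularity.StubIdeas.LiftFive2g20

open Literature.NumberTheory.Automorphic.BCDT Literature.NumberTheory.GaloisRepresentations
open Literature.NumberTheory.EllipticCurves.ModularForms WeierstrassCurve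

/-- The registered stub `stub_liftFive`, verbatim. -/
def Sig : Prop :=
  ∀ (W : WeierstrassCurve ℚ) [W.IsElliptic] (ρ : ModPGaloisRep ℚ (ZMod 5) 2),
    W.IsTorsionGaloisRep 5 ρ → ρ.IsAbsIrreducibleOverSqrt 5 → ¬ 25 ∣ W.conductorNorm ℤ →
    ρ.IsModular → W.IsModularGaloisRepTate 5

/-- P0: from the catalogued named fact CDT Thm. 7.2.2 (`25 ∤ N` unused). -/
theorem sig_of_CDT_theorem_7_2_2 (h : CDT_theorem_7_2_2) : Sig :=
  fun W _ ρ hρ hirr _ hmod ↦ lift_of_CDT_theorem_7_2_2 h W ρ hρ hirr hmod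

/-- P0″: from the Modularity Theorem named fact (BCDT Thm. A): every hypothesis unused,
through the PROVED (2) ⇒ (4) `IsModular.isModularGaloisRepTate`. -/
theorem sig_of_exists_isNewformOf (h : exists_isNewformOf) : Sig := by
  intro W _ ρ _ _ _ _
  haveI : NeZero (W.conductorNorm ℤ) := ⟨(conductorNorm_pos_holds W).ne'⟩
  exact IsModular.isModularGaloisRepTate (h W) 5

/-- The `25 ∤ N` binder is dead weight for P0: the stub with it dropped is still implied. -/
theorem sig_of_unrestricted
    (h : ∀ (W : WeierstrassCurve ℚ) [W.IsElliptic] (ρ : ModPGaloisRep ℚ (ZMod 5) 2),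
      W.IsTorsionGaloisRep 5 ρ → ρ.IsAbsIrreducibleOverSqrt 5 → ρ.IsModular →
      W.IsModularGaloisRepTate 5) : Sig :=
  fun W _ ρ hρ hirr _ hmod ↦ h W ρ hρ hirr hmod

end Summit.ABC.ABC.Cruxes.FreyModularity.StubIdeas.LiftFive2g20

end
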